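import Summits.BirchSwinnertonDyer.Rank1Residual.X5.SelfDualRelaxedStrictCount
import Summits.BirchSwinnertonDyer.Rank1Residual.Additive.PoitouTateSelmerCountingProduct
import Summits.BirchSwinnertonDyer.Rank1Residual.Additive.StabilisedDualSideSelmer
import HarnessLib

/-!
# The dual side of the count (C) READ ON `E[n]`: `H¹_{𝓕^*} = w_* R` and
# `H¹_{𝓖^*} = w_*(R ∩ loc_p⁻¹ D ∩ ⋂ loc_ℓ⁻¹ D_ℓ)` for the Poitou–Tate pair of the count, and the
# product counting form with the dual index read on `E[n]` (cell `b2b-bsdres`, CLASS-CLOSURE lane,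
# class O10 — x1b GEN 37, class lead; file 62 of the series: the Weil-transport glue between
# file 58 (Poitou–Tate product count) and files 60–61 (the stabilised dual side))

HONEST FRAMING (cell `b2b-bsdres`, run/shared/lean/b2b/bsd-rank1-residual/, verbatim in every
file): the goal of the cell is to DELETE the COMBINATION-SHAPED residual classes of the
Birch–Swinnerton-Dyer formula for ALL analytic-rank `≤ 1` elliptic curves over `ℚ` — "full BSD
formula for every rank `≤ 1` curve in class `C`" assembled STRICTLY from published theorems — so
that the rank-`≤ 1` remainder becomes exactly the CONSTRUCTION-SHAPED classes, which are TYPED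
(missing-input `Prop`s), NOT attempted. This is not "finishing BSD". CLASS-CLOSURE lane: prove
what is provable now; shrink each hard class to its core with data; no claim beyond stated classes;
research routes on CONSTRUCTION-SHAPED X12 / O10; census / instrument output = EVIDENCE / conjecture
items, NEVER a Literature fact; `RESIDUAL-MAP.md` marks change only by signed lines. THIS FILE:
TOOL THEOREMS ONLY — no definition, no named Literature fact, no Summits-side fact `def … : Prop`,
no `sorry`, axioms standard; CONDITIONAL exactly as its inputs (X11b `PoitouTateSelmerCounting`,
X5 `SelfDualRelaxedStrictCount`, file 58) on a family `inv` of local invariant maps with the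
properties of the tree's named fact `poitouTate_selmerStructure_duality` (`IsPerfect`,
`SumLocalTermEqZero`, `SelmerComplement`), and on the RESIDUAL SELF-DUALITY of the Kummer structure
(`hsd`, X5 `KummerRelaxedStrictCount.dualTransported_kummerSelmerStructure_eq`: Tate's local Euler
characteristic + the real places), all taken as HYPOTHESES; nothing is booked; no label / mark /
count / sub-cell moves; (C1_η), (C2_η-GZ), (C3_η) stay typed as filed (cc-typer-6's pen); O10 stays
OPEN / CONSTRUCTION-SHAPED; nothing about `BSD(W, p)` of any pair is claimed.

## What

The Poitou–Tate pair of the count (C) on `M = E[n]` (`n = p^m`; x1b GEN 36 note §2) is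
`𝓕 = 𝓚[v₀ ↦ 0]` (Kummer away from `v₀ = (p)`, STRICT at `v₀`; `H¹_𝓕 ≅ S₀`) `≤ 𝓖` (at `v₀` a
condition `C'`, at the finitely many `v ∈ T` conditions `𝓖_v ⊇ 𝓚_v` — the level-`∞` kernels
`𝒦_{m,v}` —, Kummer elsewhere; `H¹_𝓖 ≅ A₀`).  File 58 gives
`[H¹_𝓖 : H¹_𝓕] · [H¹_{𝓕^*}(K, M^D) : H¹_{𝓖^*}(K, M^D)] = #C' · ∏_{v∈T} [𝓖_v : 𝓚_v]`; files 60–61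
compute an index of subgroups of `H¹(K, E[n])`.  THIS FILE identifies the two through the Weil
transport `w : E[n] ⥲ E[n]^D` (X5 `dualSelmerGroup_eq_map_selmerGroup_dualTransported`):

* §1 (any finite module) `dualLocalCondition_map_nsmul` — `(k·C)^* = [k]⁻¹(C^*)`;
  `dualTransported_update` — `w⁻¹((𝓛[v₀ ↦ X])^*) = (w⁻¹𝓛^*)[v₀ ↦ w⁻¹(X^*)]`;
  `selmerGroup_eq_inf_comap_inf_iInf` — `H¹_𝓑 = H¹_𝓐 ∩ loc_{v₀}⁻¹ 𝓑_{v₀} ∩ ⋂_{v∈T} loc_v⁻¹ 𝓑_v` for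
  `𝓑 ≤ 𝓐` agreeing off `{v₀} ∪ T`.
* §2 (the Kummer structure `𝓚` on `E[n]`, residually self-dual: `w⁻¹(𝓚_v^*) = 𝓚_v` at every `v`)
  `dualSelmerGroup_update_bot_eq_map` — **`H¹_{𝓕^*}(K, E[n]^D) = H¹(w)(R)`**, `R = H¹_{𝓚[v₀ ↦ ⊤]}` the
  Kummer structure RELAXED at `v₀`; `dualSelmerGroup_eq_map_inf` —
  **`H¹_{𝓖^*}(K, E[n]^D) = H¹(w)(R ∩ loc_{v₀}⁻¹ D₀ ∩ ⋂_{v∈T} loc_v⁻¹ D_v)`** with `D₀ = w⁻¹(C'^*)`,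
  `D_v = w⁻¹(𝓖_v^*) ⊆ 𝓚_v`; `relIndex_dual_eq` — hence `[H¹_{𝓕^*} : H¹_{𝓖^*}] = [R : R ∩ …]`
  (`H¹(w)` injective); **`relIndex_mul_relIndex_inf_eq_card_mul_prod`** — file 58 read on `E[n]`:
  `[H¹_𝓖 : H¹_𝓕] · [R : R ∩ loc_{v₀}⁻¹ D₀ ∩ ⋂_{v∈T} loc_v⁻¹ D_v] = #C' · ∏_{v∈T} [𝓖_v : 𝓚_v]`.

With `C' = p^t · C` (`D₀ = [p^t]⁻¹ w⁻¹(C^*)` by §1) the second factor is file 61's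
`relIndex_dualSide_eq_prime_pow` (`= p^{m−t−ν}`) — the sequel assembles them.

NOT here: the bridge `H¹_𝓖 ≅ A₀`, `H¹_𝓕 ≅ S₀`; B3; the arithmetic discharges of file 61's hypotheses.

References: [Howard2004HeegnerKolyvagin] Def. 2.1.6, 2.1.10, Thm. 2.1.11; [MilneADT2006] I Cor. 2.3,
Thm. 4.10, Lemma 6.15; [Sakamoto2024] §3.1.2; [GreenbergLNM1716] §4 (pp. 98–103).
-/

noncomputable section

open scoped Classical

universe u

open CategoryTheory Field Function NumberField IsDedekindDomain WeierstrassCurve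
open Literature.NumberTheory.EllipticCurves
open Literature.NumberTheory.GaloisRepresentations
open Literature.NumberTheory.GaloisRepresentations.DiscreteGaloisModule (mu MuCarrier SelmerStructure
  localTatePairingZMod tateDual localMap)
open Literature.NumberTheory.GaloisCohomology
open Summit.BirchSwinnertonDyer.Rank1Residual.X11b.LocBridge
open Summit.BirchSwinnertonDyer.Rank1Residual.X11b.Levels
open Summit.BirchSwinnertonDyer.Rank1Residual.X5.SelfDualCount
open Summit.BirchSwinnertonDyer.Rank1Residual.GaloisImage.CoreRankZero (selmerGroup_mono)
open scoped ContRepresentation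

namespace Summit.BirchSwinnertonDyer.Rank1Residual.Additive.StabilisedDualTransport


/-! ## §1. Three pieces of Selmer-structure bookkeeping (any finite module) -/

section Generic

variable {K : Type u} [Field K] [NumberField K] {n : ℕ} {M : Type u} [AddCommGroup M]
  [TopologicalSpace M] [DiscreteTopology M] [Finite M] (inv : LocalInvariants K n)
  (ρ : DiscreteGaloisModule K M)

/-- **`(k·C)^* = [k]⁻¹(C^*)`**: the annihilator of the image `k • C` of a local condition under
multiplication by `k` is the preimage under multiplication by `k` of the annihilator of `C`
(`⟨k a, b⟩_v = ⟨a, k b⟩_v`, bi-additivity of the local Tate pairing).  In (C): `C' = p^t · C_m` at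
`v₀ = (p)`. [cite: Howard2004HeegnerKolyvagin, Def. 2.1.6 (arXiv:1202.6340 p. 5)] -/
theorem dualLocalCondition_map_nsmul (v : Place K)
    (C : AddSubgroup (galoisCohomology (ρ.toLocal v) 1)) (k : ℕ) :
    inv.dualLocalCondition ρ v (C.map (nsmulAddMonoidHom k)) =
      (inv.dualLocalCondition ρ v C).comap (nsmulAddMonoidHom k) := by
  ext y
  simp only [LocalInvariants.mem_dualLocalCondition_iff, AddSubgroup.mem_comap, AddSubgroup.mem_map,
    nsmulAddMonoidHom_apply]
  constructor
  · intro h a ha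
    have h' := h (k • a) ⟨a, ha, rfl⟩
    rw [map_nsmul, AddMonoidHom.nsmul_apply] at h'
    rw [map_nsmul]
    exact h'
  · rintro h b ⟨a, ha, rfl⟩
    have h' := h a ha
    rw [map_nsmul] at h'
    rw [map_nsmul, AddMonoidHom.nsmul_apply]
    exact h'

/-- **`w⁻¹((𝓛[v₀ ↦ X])^*) = (w⁻¹𝓛^*)[v₀ ↦ w⁻¹(X^*)]`**: transporting the dual of a structure modified
at one place modifies the transported dual at that place only (generalises X5's
`dualTransported_update_bot` / `_top`). [cite: Sakamoto2024, §3.1.2 (p. 924)]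
[cite: Howard2004HeegnerKolyvagin, Def. 2.1.10 (arXiv:1202.6340 p. 6)] -/
theorem dualTransported_update (𝓛 : SelmerStructure ρ)
    (θ : ρ.toContRepresentation →ⁱL (ρ.tateDual n).toContRepresentation) (v₀ : Place K)
    (X : AddSubgroup (galoisCohomology (ρ.toLocal v₀) 1)) :
    inv.dualTransported (Function.update 𝓛 v₀ X) θ =
      Function.update (inv.dualTransported 𝓛 θ) v₀
        ((inv.dualLocalCondition ρ v₀ X).comap (localMap θ v₀)) := by
  funext v
  by_cases hv : v = v₀
  · subst hv
    rw [Function.update_self]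
    ext y
    simp only [LocalInvariants.mem_dualTransported_iff, LocalInvariants.dualSelmerStructure_apply,
      Function.update_self, AddSubgroup.mem_comap]
  · rw [Function.update_of_ne hv]
    ext y
    simp only [LocalInvariants.mem_dualTransported_iff, LocalInvariants.dualSelmerStructure_apply,
      Function.update_of_ne hv]

omit [Finite M] in
/-- **`H¹_𝓑 = H¹_𝓐 ∩ loc_{v₀}⁻¹(𝓑_{v₀}) ∩ ⋂_{w ∈ T} loc_w⁻¹(𝓑_w)`** for Selmer structures `𝓑 ≤ 𝓐`
agreeing at every place other than `v₀` and the finite places of `T` (exactness of Howard's first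
sequence on the left, several places at once). [folklore] -/
theorem selmerGroup_eq_inf_comap_inf_iInf {𝓐 𝓑 : SelmerStructure ρ} (v₀ : Place K)
    (T : Finset (HeightOneSpectrum (𝓞 K))) (hle : 𝓑 ≤ 𝓐)
    (hoff : ∀ v : Place K, v ≠ v₀ → (∀ w ∈ T, v ≠ Sum.inr w) → 𝓑 v = 𝓐 v) :
    𝓑.selmerGroup =
      𝓐.selmerGroup ⊓ (𝓑 v₀).comap (galoisCohomology.localization ρ v₀ 1) ⊓
        ⨅ w : ↥T, (𝓑 (Sum.inr (w : HeightOneSpectrum (𝓞 K)))).comap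
          (galoisCohomology.localization ρ (Sum.inr (w : HeightOneSpectrum (𝓞 K))) 1) := by
  ext c
  simp only [AddSubgroup.mem_inf, AddSubgroup.mem_iInf, AddSubgroup.mem_comap,
    SelmerStructure.mem_selmerGroup_iff]
  constructor
  · intro h
    exact ⟨⟨fun v => hle v (h v), h v₀⟩, fun w => h _⟩
  · rintro ⟨⟨hA, h₀⟩, hT⟩ v
    by_cases hv : v = v₀
    · subst hv; exact h₀
    · by_cases hw : ∃ w ∈ T, v = Sum.inr w
      · obtain ⟨w, hwT, rfl⟩ := hw
        exact hT ⟨w, hwT⟩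
      · rw [hoff v hv (fun w hwT h => hw ⟨w, hwT, h⟩)]
        exact hA v

end Generic

/-! ## §2. The Kummer structure: the dual Selmer groups of the count read on `E[n]` -/

section Kummer

variable {K : Type u} [Field K] [NumberField K] (W : WeierstrassCurve K) (n : ℕ) [NeZero n]
  [W.IsElliptic] [Finite (geomTorsion W n)]
variable (e : geomTorsion W n → geomTorsion W n → AlgebraicClosure K)
  (hμ : ∀ S T, e S T ^ n = 1)
  (hadd₁ : ∀ S₁ S₂ T, e (S₁ + S₂) T = e S₁ T * e S₂ T)
  (hadd₂ : ∀ S T₁ T₂, e S (T₁ + T₂) = e S T₁ * e S T₂)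
  (hgal : ∀ (σ : absoluteGaloisGroup K) (S T : geomTorsion W n), σ • e S T = e (σ • S) (σ • T))
  (hnondeg : ∀ T, (∀ S, e S T = 1) → T = 0)
  (inv : LocalInvariants K n)

include hnondeg in
/-- **`H¹_{(𝓚[v₀ ↦ 0])^*}(K, E[n]^D) = H¹(w)(H¹_{𝓚[v₀ ↦ ⊤]}(K, E[n]))`**: the dual Selmer group of the
Kummer structure made STRICT at `v₀` is the Weil transport of the Selmer group `R` of the Kummer
structure RELAXED at `v₀` — for `𝓚` residually self-dual at every place (`hsd`).  In (C):
`H¹_{𝓕^*} = w_* R_m`, `R_m = Sel^{rel@p}_{p^m}(W/ℚ)`.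
[cite: Howard2004HeegnerKolyvagin, Def. 2.1.1 and Def. 2.1.6 (arXiv:1202.6340 p. 5)]
[cite: Sakamoto2024, §3.1.2 (p. 924)] -/
theorem dualSelmerGroup_update_bot_eq_map
    (hsd : ∀ v, inv.dualTransported (W.kummerSelmerStructure (n : ℤ))
      (weilDualIntertwining W n e hμ hadd₁ hadd₂ hgal) v = W.kummerSelmerStructure (n : ℤ) v)
    (v₀ : Place K) :
    (inv.dualSelmerStructure (W.torsionGaloisModule n)
        (Function.update (W.kummerSelmerStructure (n : ℤ)) v₀ ⊥)).selmerGroup =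
      (SelmerStructure.selmerGroup (Function.update (W.kummerSelmerStructure (n : ℤ)) v₀ ⊤ :
          SelmerStructure (W.torsionGaloisModule n))).map
        (galoisCohomology.map (weilDualIntertwining W n e hμ hadd₁ hadd₂ hgal) 1) := by
  rw [dualSelmerGroup_eq_map_selmerGroup_dualTransported W n e hμ hadd₁ hadd₂ hgal hnondeg inv,
    dualTransported_update_bot]
  congr 2
  funext v
  by_cases hv : v = v₀
  · subst hv; rw [Function.update_self, Function.update_self]
  · rw [Function.update_of_ne hv, Function.update_of_ne hv, hsd v]

include hnondeg in
/-- **`H¹_{𝓖^*}(K, E[n]^D) = H¹(w)(R ∩ loc_{v₀}⁻¹ D₀ ∩ ⋂_{w∈T} loc_w⁻¹ D_w)`** for a structure `𝓖`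
that is `𝓖_{v₀}` (anything) at `v₀`, ENLARGES the Kummer condition at the finite places of `T`
(`𝓚_w ≤ 𝓖_w`) and is Kummer elsewhere: here `R = H¹_{𝓚[v₀ ↦ ⊤]}`, `D₀ = w⁻¹(𝓖_{v₀}^*)`,
`D_w = w⁻¹(𝓖_w^*) ⊆ w⁻¹(𝓚_w^*) = 𝓚_w` (residual self-duality `hsd`), all read on `E[n]`.  In (C):
`𝓖_{v₀} = p^t·C_m`, `𝓖_ℓ = 𝒦_{m,ℓ}`. [cite: Howard2004HeegnerKolyvagin, Def. 2.1.10 and Thm. 2.1.11 (arXiv:1202.6340 p. 6)]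
[cite: Sakamoto2024, §3.1.2 (p. 924)] -/
theorem dualSelmerGroup_eq_map_inf
    (hsd : ∀ v, inv.dualTransported (W.kummerSelmerStructure (n : ℤ))
      (weilDualIntertwining W n e hμ hadd₁ hadd₂ hgal) v = W.kummerSelmerStructure (n : ℤ) v)
    (v₀ : Place K) (T : Finset (HeightOneSpectrum (𝓞 K))) (hv₀T : ∀ w ∈ T, v₀ ≠ Sum.inr w)
    (𝓖 : SelmerStructure (W.torsionGaloisModule n))
    (h𝓖T : ∀ w ∈ T, W.kummerSelmerStructure (n : ℤ) (Sum.inr w) ≤ 𝓖 (Sum.inr w))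
    (h𝓖off : ∀ v : Place K, v ≠ v₀ → (∀ w ∈ T, v ≠ Sum.inr w) →
      𝓖 v = W.kummerSelmerStructure (n : ℤ) v) :
    (inv.dualSelmerStructure (W.torsionGaloisModule n) 𝓖).selmerGroup =
      ((SelmerStructure.selmerGroup (Function.update (W.kummerSelmerStructure (n : ℤ)) v₀ ⊤ :
            SelmerStructure (W.torsionGaloisModule n))) ⊓
          (inv.dualTransported 𝓖 (weilDualIntertwining W n e hμ hadd₁ hadd₂ hgal) v₀).comap
            (galoisCohomology.localization (W.torsionGaloisModule n) v₀ 1) ⊓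
          ⨅ w : ↥T, (inv.dualTransported 𝓖 (weilDualIntertwining W n e hμ hadd₁ hadd₂ hgal)
              (Sum.inr (w : HeightOneSpectrum (𝓞 K)))).comap
            (galoisCohomology.localization (W.torsionGaloisModule n)
              (Sum.inr (w : HeightOneSpectrum (𝓞 K))) 1)).map
        (galoisCohomology.map (weilDualIntertwining W n e hμ hadd₁ hadd₂ hgal) 1) := by
  rw [dualSelmerGroup_eq_map_selmerGroup_dualTransported W n e hμ hadd₁ hadd₂ hgal hnondeg inv]
  congr 1
  refine selmerGroup_eq_inf_comap_inf_iInf (W.torsionGaloisModule n) v₀ T ?_ ?_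
  · -- `w⁻¹𝓖^* ≤ 𝓚[v₀ ↦ ⊤]`
    intro v
    by_cases hv : v = v₀
    · subst hv; rw [Function.update_self]; exact le_top
    · rw [Function.update_of_ne hv]
      by_cases hw : ∃ w ∈ T, v = Sum.inr w
      · obtain ⟨w, hwT, rfl⟩ := hw
        rw [← hsd (Sum.inr w)]
        intro y hy
        rw [LocalInvariants.mem_dualTransported_iff, LocalInvariants.dualSelmerStructure_apply] at hy ⊢
        exact inv.dualLocalCondition_anti _ _ (h𝓖T w hwT) hy
      · rw [← hsd v]
        intro y hy
        rw [LocalInvariants.mem_dualTransported_iff, LocalInvariants.dualSelmerStructure_apply] at hy ⊢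
        rw [h𝓖off v hv (fun w hwT h => hw ⟨w, hwT, h⟩)] at hy
        exact hy
  · intro v hv hw
    rw [Function.update_of_ne hv, ← hsd v]
    ext y
    rw [LocalInvariants.mem_dualTransported_iff, LocalInvariants.dualSelmerStructure_apply,
      LocalInvariants.mem_dualTransported_iff, LocalInvariants.dualSelmerStructure_apply, h𝓖off v hv hw]

include hnondeg in
/-- **`[H¹_{𝓕^*} : H¹_{𝓖^*}] = [R : R ∩ loc_{v₀}⁻¹ D₀ ∩ ⋂_{w∈T} loc_w⁻¹ D_w]`** for the Poitou–Tate pair of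
the count (`𝓕 = 𝓚[v₀ ↦ 0] ≤ 𝓖` as in `dualSelmerGroup_eq_map_inf`): the dual index of file 58, READ ON
`E[n]` (`H¹(w)` is injective). [cite: Howard2004HeegnerKolyvagin, Thm. 2.1.11 (arXiv:1202.6340 p. 6)]
[cite: Sakamoto2024, §3.1.2 (p. 924)] -/
theorem relIndex_dual_eq
    (hsd : ∀ v, inv.dualTransported (W.kummerSelmerStructure (n : ℤ))
      (weilDualIntertwining W n e hμ hadd₁ hadd₂ hgal) v = W.kummerSelmerStructure (n : ℤ) v)
    (v₀ : Place K) (T : Finset (HeightOneSpectrum (𝓞 K))) (hv₀T : ∀ w ∈ T, v₀ ≠ Sum.inr w)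
    (𝓖 : SelmerStructure (W.torsionGaloisModule n))
    (h𝓖T : ∀ w ∈ T, W.kummerSelmerStructure (n : ℤ) (Sum.inr w) ≤ 𝓖 (Sum.inr w))
    (h𝓖off : ∀ v : Place K, v ≠ v₀ → (∀ w ∈ T, v ≠ Sum.inr w) →
      𝓖 v = W.kummerSelmerStructure (n : ℤ) v) :
    (inv.dualSelmerStructure (W.torsionGaloisModule n) 𝓖).selmerGroup.relIndex
        (inv.dualSelmerStructure (W.torsionGaloisModule n)
          (Function.update (W.kummerSelmerStructure (n : ℤ)) v₀ ⊥)).selmerGroup =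
      ((SelmerStructure.selmerGroup (Function.update (W.kummerSelmerStructure (n : ℤ)) v₀ ⊤ :
            SelmerStructure (W.torsionGaloisModule n))) ⊓
          (inv.dualTransported 𝓖 (weilDualIntertwining W n e hμ hadd₁ hadd₂ hgal) v₀).comap
            (galoisCohomology.localization (W.torsionGaloisModule n) v₀ 1) ⊓
          ⨅ w : ↥T, (inv.dualTransported 𝓖 (weilDualIntertwining W n e hμ hadd₁ hadd₂ hgal)
              (Sum.inr (w : HeightOneSpectrum (𝓞 K)))).comap
            (galoisCohomology.localization (W.torsionGaloisModule n)
              (Sum.inr (w : HeightOneSpectrum (𝓞 K))) 1)).relIndex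
        (SelmerStructure.selmerGroup (Function.update (W.kummerSelmerStructure (n : ℤ)) v₀ ⊤ :
            SelmerStructure (W.torsionGaloisModule n))) := by
  rw [dualSelmerGroup_eq_map_inf W n e hμ hadd₁ hadd₂ hgal hnondeg inv hsd v₀ T hv₀T 𝓖 h𝓖T h𝓖off,
    dualSelmerGroup_update_bot_eq_map W n e hμ hadd₁ hadd₂ hgal hnondeg inv hsd v₀,
    AddSubgroup.relIndex_map_map_of_injective _ _
      (map_weilDual_injective W n e hμ hadd₁ hadd₂ hgal hnondeg)]

include hnondeg in
/-- **The product counting form of Poitou–Tate with the dual index read on `E[n]`.**  For the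
Kummer structure `𝓚` on `E[n]` unramified outside `S ⊇ {v ∣ ∞} ∪ {v ∣ n} ∪ Ram(E[n])`, residually
self-dual (`hsd`), a finite place `w₀ ∈ S` and a finite set `T ⊆ S` of OTHER finite places, and a
structure `𝓖` which is `𝓖_{v₀}` at `v₀ = w₀`, enlarges `𝓚` on `T` and is Kummer elsewhere:
**`[H¹_𝓖 : H¹_{𝓚[v₀ ↦ 0]}] · [R : R ∩ loc_{v₀}⁻¹ D₀ ∩ ⋂_{w∈T} loc_w⁻¹ D_w] = #𝓖_{v₀} · ∏_{w∈T} [𝓖_w : 𝓚_w]`**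
(`R = H¹_{𝓚[v₀ ↦ ⊤]}`, `D₀ = w⁻¹(𝓖_{v₀}^*)`, `D_w = w⁻¹(𝓖_w^*)`) — file 58
(`PoitouTateCountingProduct.relIndex_selmerGroup_mul_relIndex_dual_eq_prod`, `T ∪ {w₀}`) with the
dual factor rewritten by `relIndex_dual_eq`.  In (C): the left factor is `#(A₀ ⧸ S₀)` (bridge), the
right side `#(p^t C_m) · ∏_ℓ #𝒦_{ℓ,0}`, and the middle factor is file 61's `p^{n−ν}`.
CONDITIONAL on the properties of `inv` and on `hsd` (hypotheses); nothing booked.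
[cite: Howard2004HeegnerKolyvagin, Thm. 2.1.11 (arXiv:1202.6340 p. 6)] [cite: MilneADT2006, I Thm. 4.10]
[cite: GreenbergLNM1716, §4 (pp. 98–103)] -/
theorem relIndex_mul_relIndex_inf_eq_card_mul_prod (hperf : inv.IsPerfect)
    (hvan : inv.SumLocalTermEqZero) (hcomp : inv.SelmerComplement) {S : Finset (Place K)}
    (hS : ∀ v : HeightOneSpectrum (𝓞 K), (Sum.inr v : Place K) ∉ S →
      ((n : ℕ) : 𝓞 K) ∉ v.asIdeal ∧ GaloisRep.IsUnramifiedAt v (W.torsionGaloisModule n))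
    (h𝓚 : SelmerStructure.IsUnramifiedOutside (W.kummerSelmerStructure (n : ℤ) :
      SelmerStructure (W.torsionGaloisModule n)) S)
    (hsd : ∀ v, inv.dualTransported (W.kummerSelmerStructure (n : ℤ))
      (weilDualIntertwining W n e hμ hadd₁ hadd₂ hgal) v = W.kummerSelmerStructure (n : ℤ) v)
    {w₀ : HeightOneSpectrum (𝓞 K)} (hw₀ : (Sum.inr w₀ : Place K) ∈ S)
    (T : Finset (HeightOneSpectrum (𝓞 K))) (hw₀T : w₀ ∉ T)
    (hT : ∀ w ∈ T, (Sum.inr w : Place K) ∈ S)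
    (𝓖 : SelmerStructure (W.torsionGaloisModule n))
    (h𝓖T : ∀ w ∈ T, W.kummerSelmerStructure (n : ℤ) (Sum.inr w) ≤ 𝓖 (Sum.inr w))
    (h𝓖off : ∀ v : Place K, v ≠ Sum.inr w₀ → (∀ w ∈ T, v ≠ Sum.inr w) →
      𝓖 v = W.kummerSelmerStructure (n : ℤ) v) :
    (SelmerStructure.selmerGroup (Function.update (W.kummerSelmerStructure (n : ℤ)) (Sum.inr w₀) ⊥ :
          SelmerStructure (W.torsionGaloisModule n))).relIndex 𝓖.selmerGroup *
      ((SelmerStructure.selmerGroup (Function.update (W.kummerSelmerStructure (n : ℤ))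
              (Sum.inr w₀) ⊤ : SelmerStructure (W.torsionGaloisModule n))) ⊓
          (inv.dualTransported 𝓖 (weilDualIntertwining W n e hμ hadd₁ hadd₂ hgal) (Sum.inr w₀)).comap
            (galoisCohomology.localization (W.torsionGaloisModule n) (Sum.inr w₀) 1) ⊓
          ⨅ w : ↥T, (inv.dualTransported 𝓖 (weilDualIntertwining W n e hμ hadd₁ hadd₂ hgal)
              (Sum.inr (w : HeightOneSpectrum (𝓞 K)))).comap
            (galoisCohomology.localization (W.torsionGaloisModule n)
              (Sum.inr (w : HeightOneSpectrum (𝓞 K))) 1)).relIndex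
        (SelmerStructure.selmerGroup (Function.update (W.kummerSelmerStructure (n : ℤ))
          (Sum.inr w₀) ⊤ : SelmerStructure (W.torsionGaloisModule n))) =
      Nat.card (𝓖 (Sum.inr w₀)) *
        ∏ w ∈ T, (W.kummerSelmerStructure (n : ℤ) (Sum.inr w)).relIndex (𝓖 (Sum.inr w)) := by
  set v₀ : Place K := Sum.inr w₀ with hv₀
  set 𝓚 : SelmerStructure (W.torsionGaloisModule n) := W.kummerSelmerStructure (n : ℤ) with h𝓚def
  set 𝓕 : SelmerStructure (W.torsionGaloisModule n) := Function.update 𝓚 v₀ ⊥ with h𝓕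
  have hM : ∀ P : geomTorsion W n, n • P = 0 := fun P => AddSubgroup.torsionBy.nsmul P
  have hv₀T : ∀ w ∈ T, v₀ ≠ Sum.inr w := fun w hw h => hw₀T (by
    rw [hv₀] at h; exact (Sum.inr_injective h) ▸ hw)
  -- `𝓕 ≤ 𝓖`, `𝓖` unramified outside `S`, and they agree off `{w₀} ∪ T`
  have hle : 𝓕 ≤ 𝓖 := fun v => by
    by_cases hv : v = v₀
    · subst hv; rw [h𝓕, Function.update_self]; exact bot_le
    · rw [h𝓕, Function.update_of_ne hv]
      by_cases hw : ∃ w ∈ T, v = Sum.inr w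
      · obtain ⟨w, hwT, rfl⟩ := hw
        exact h𝓖T w hwT
      · rw [h𝓖off v hv (fun w hwT h => hw ⟨w, hwT, h⟩)]
  have h𝓖S : 𝓖.IsUnramifiedOutside S := by
    refine ⟨h𝓚.1, fun v hv => ?_⟩
    have hne : (Sum.inr v : Place K) ≠ v₀ := fun h => hv (h ▸ hw₀)
    have hnT : ∀ w ∈ T, (Sum.inr v : Place K) ≠ Sum.inr w := fun w hw h =>
      hv ((Sum.inr_injective h) ▸ hT w hw)
    rw [h𝓖off _ hne hnT]
    exact h𝓚.2 v hv
  have hdiff : ∀ v : Place K, (∀ w ∈ insert w₀ T, v ≠ Sum.inr w) → 𝓕 v = 𝓖 v := by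
    intro v hv
    have hne : v ≠ v₀ := hv w₀ (Finset.mem_insert_self w₀ T)
    have hnT : ∀ w ∈ T, v ≠ Sum.inr w := fun w hw => hv w (Finset.mem_insert_of_mem hw)
    rw [h𝓕, Function.update_of_ne hne, h𝓖off v hne hnT]
  have hT' : ∀ w ∈ insert w₀ T, (Sum.inr w : Place K) ∈ S := fun w hw => by
    rcases Finset.mem_insert.mp hw with rfl | hw'
    · exact hw₀
    · exact hT w hw'
  -- file 58
  have h58 := PoitouTateCountingProduct.relIndex_selmerGroup_mul_relIndex_dual_eq_prod
    (ρ := W.torsionGaloisModule n) hperf hvan hcomp hM hS (insert w₀ T) hT' hle h𝓖S hdiff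
  rw [Finset.prod_insert hw₀T] at h58
  -- the dual factor read on `E[n]`
  rw [h𝓕, relIndex_dual_eq W n e hμ hadd₁ hadd₂ hgal hnondeg inv hsd v₀ T hv₀T 𝓖 h𝓖T h𝓖off] at h58
  rw [h58]
  have h0 : Function.update 𝓚 v₀ ⊥ (Sum.inr w₀) = ⊥ := by rw [← hv₀, Function.update_self]
  have h1 : ∀ w ∈ T, Function.update 𝓚 v₀ ⊥ (Sum.inr w) = 𝓚 (Sum.inr w) := fun w hw =>
    Function.update_of_ne (hv₀T w hw).symm _ _
  rw [h0, AddSubgroup.relIndex_bot_left]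
  congr 1
  exact Finset.prod_congr rfl fun w hw => by rw [h1 w hw]

end Kummer

end Summit.BirchSwinnertonDyer.Rank1Residual.Additive.StabilisedDualTransport

end
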